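import Literature.Barriers.CriticalPhenomena.RigorousRGSmallParameterGaussianIBP
import Literature.Barriers.CriticalPhenomena.RigorousRGSmallParameterPerturbativeRange
import HarnessLib

/-!
# `RigorousRGSmallParameter` (Slade, Theorem 1.4.1): Wick's theorem — the Gaussian expectation
# acts on polynomials as the heat operator, `E_Cθ F = e^{ℒ_C}F`, `ℒ_C = ½Δ_C`

Companion ("proof architecture") file of
`Literature/Barriers/CriticalPhenomena/RigorousRGSmallParameter.lean`. Slade §4.3 defines the
perturbative map through `ℒ_C = ½Δ_C` and `e^{±ℒ_C}` "defined by power series expansion, which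
terminates when applied to a polynomial", relying on the basic property of Gaussian integration
([BS-rg-norm] §2) that the convolution `E_Cθ` (`thetaConv (fieldGaussian Λ C n)`, Slade §4.1,
file `…GaussianIntegration`) acts on polynomials as `e^{ℒ_C}` (the truncated exponential `expL`
of `…PerturbativeFunctionals` / `expLap` of `…TphiHeat`). This file PROVES it:

**`thetaConv_eq_expL`.** For positive semidefinite `C`, a smooth `F` on field space whose
coefficients of length `> A` vanish (a polynomial of degree `≤ A`), and a truncation order `A'`
with `A ≤ 2A'`: `∫ F(φ + ζ) dP_C(ζ) = e^{ℒ_C}F(φ) = Σ_{k ≤ A'} (½)^k/k! Δ_C^kF(φ)`.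

Proof (creation identities + induction on the degree): for the multiplication by a coordinate
`φ_u`, `u = (x,i)`, Gaussian integration by parts (`…GaussianIBP.fieldGaussian_ibp`) gives
`E_Cθ(φ_uφ^z) = φ_uE_Cθ(φ^z) + Σ_y C_{xy}E_Cθ(∂_{(y,i)}φ^z)` (`thetaConv_ev_mul_mono`), while the
Leibniz rule for `Δ_C` (`…TphiHeatAlgebra.lapC_mul`) gives `Δ_C(φ_uF) = φ_uΔ_CF + 2Σ_vĈ_{uv}∂_vF`,
hence `Δ_C^{k+1}(φ_uF) = φ_uΔ_C^{k+1}F + 2(k+1)Σ_vĈ_{uv}∂_vΔ_C^kF` and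
`e^{tΔ_C}(φ_uF) = φ_ue^{tΔ_C}F + 2tΣ_vĈ_{uv}∂_ve^{tΔ_C}F` (`expLap_ev_mul`); with `t = ½` the two
operators satisfy the same recursion, both fix constants and are linear, so they agree on all
monomials `φ^z` by induction on `|z|` (`thetaConv_mono`; `∂_vφ^z` is a sum of shorter monomials,
`coeff_single_mono`), and on all polynomials by the exact Taylor expansion in monomials
(`eq_sum_mono`, from `…TphiPolynomial.coeff_apply_eq_taylor`).

Sources: D. C. Brydges, G. Slade [BS-rg-norm] arXiv:1403.7244, §2; G. Slade, arXiv:1611.06169,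
§4.1, §4.3.

## What this file provides (definitions with proved properties; no named fact)

* `mono` (coordinate monomials `φ^z`), `mono_nil`, `mono_cons`, `contDiff_mono`,
  **`coeff_single_mono`**, `coeff_ev_eq_zero`, **`coeff_mono_eq_zero`**, `polyDeg_mono`, `abs_mono_le`.
* `coeff_single_lapC`, **`lapC_ev_mul`**, `lapC_ev_mul_symm`, **`lapPow_ev_mul`**, **`expLap_ev_mul`**.
* `integrable_fieldGaussian_of_abs_le`, `abs_mono_shift_le`, `fderiv_mono_apply`,
  `norm_fderiv_mono_le`, **`thetaConv_ev_mul_mono`**.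
* `coeff_single_lapPow`, `coeff_single_expL`, `lapPow_succ_const`, `expL_const`, `lapCov_symm`,
  `thetaConv_const`, `thetaConv_finset_sum`, `thetaConv_const_mul`, **`thetaConv_mono`**,
  `cpow_fieldFn`, **`eq_sum_mono`**, **`thetaConv_eq_expL`**.

## References

* [BrydgesSlade2015RGI] D. C. Brydges, G. Slade, *A renormalisation group method. I. Gaussian
  integration and normed algebras*, J. Stat. Phys. 159 (2015) 421–460, arXiv:1403.7244 — §2.
* [Slade2017] G. Slade, *Critical exponents for long-range O(n) models below the upper critical
  dimension*, Commun. Math. Phys. 358 (2018) 343–436, arXiv:1611.06169 — §4.1, §4.3.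
-/

noncomputable section

namespace Literature.Barriers.CriticalPhenomena

namespace LongRangePhi4

namespace Wick

open MeasureTheory ProbabilityTheory Finset Tphi RGNorm LocalPoly Loc PTFun GaussIBP Literature.Probability.LatticeModels
open scoped ContDiff

variable {d M n : ℕ} [NeZero M]

/-! ### Monomials `φ^z = ∏_k φ_{z_k}` in the coordinates -/

/-- **The coordinate monomial** `φ^z = ∏_{k} φ^{i_k}_{x_k}` for a word `z = ((x_1,i_1),…)`. [folklore] -/
def mono (z : List (TorusSite d M × Fin n)) : (TorusSite d M → Fin n → ℝ) → ℝ := fun φ => (z.map fun v => φ v.1 v.2).prod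

omit [NeZero M] in
/-- `φ^{[]} = 1`. [folklore] -/
@[simp] theorem mono_nil : mono (d := d) (M := M) (n := n) [] = fun _ => 1 := by funext φ; simp [mono]

omit [NeZero M] in
/-- `φ^{a·z} = φ_a φ^z`. [folklore] -/
theorem mono_cons (a : TorusSite d M × Fin n) (z : List (TorusSite d M × Fin n)) :
    mono (a :: z) = fun φ => ev a φ * mono z φ := by funext φ; simp [mono, ev]

/-- Monomials are smooth. [folklore] -/
theorem contDiff_mono : ∀ z : List (TorusSite d M × Fin n), ContDiff ℝ ∞ (mono z)
  | [] => by rw [mono_nil]; exact contDiff_const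
  | a :: z => by rw [mono_cons]; exact (contDiff_ev a).mul (contDiff_mono z)

/-- **Product rule for the first coefficient of a monomial**:
`(φ^z)_{[v]} = Σ_{k : z_k = v} φ^{z ∖ k}`. [folklore] -/
theorem coeff_single_mono (v : TorusSite d M × Fin n) : ∀ z : List (TorusSite d M × Fin n),
    coeff (basisDir d M n) [v] (mono z) =
      fun φ => ∑ k ∈ range z.length, (if z[k]? = some v then mono (z.eraseIdx k) φ else 0)
  | [] => by
      funext φ
      rw [coeff_cons, coeff_nil, mono_nil]
      simp [Tphi.dirDeriv]
  | a :: z => by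
      funext φ
      rw [coeff_cons, coeff_nil, mono_cons,
        dirDeriv_mul _ (differentiable_of_contDiff (contDiff_ev a)) (differentiable_of_contDiff (contDiff_mono z))]
      have ih := congrFun (coeff_single_mono v z) φ
      rw [coeff_cons, coeff_nil] at ih
      show dirDeriv (basisDir d M n v) (ev a) φ * mono z φ + ev a φ * dirDeriv (basisDir d M n v) (mono z) φ = _
      rw [ih, congrFun (dirDeriv_ev a v) φ, List.length_cons, Finset.sum_range_succ']
      simp only [List.getElem?_cons_succ, List.getElem?_cons_zero, Option.some.injEq, List.eraseIdx_cons_succ,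
        List.eraseIdx_cons_zero, mono_cons, Finset.mul_sum]
      rw [add_comm]
      congr 1
      · refine Finset.sum_congr rfl fun k _ => ?_
        split_ifs <;> ring
      · by_cases h : a = v <;> simp [h]

/-- Second and higher coefficients of the linear functional `φ ↦ φ_a` vanish. [folklore] -/
theorem coeff_ev_eq_zero (a b c : TorusSite d M × Fin n) : ∀ w : List (TorusSite d M × Fin n),
    coeff (basisDir d M n) (b :: c :: w) (ev a) = fun _ => 0
  | [] => by
      rw [coeff_cons, coeff_cons, coeff_nil, dirDeriv_ev]
      funext φ; simp [Tphi.dirDeriv]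
  | x :: w => by
      rw [coeff_cons, coeff_ev_eq_zero a c x w]
      funext φ; simp [Tphi.dirDeriv]

/-- **Monomials are polynomials**: the coefficients of `φ^z` of length `> |z|` vanish. [folklore] -/
theorem coeff_mono_eq_zero : ∀ (z : List (TorusSite d M × Fin n)) (w : List (TorusSite d M × Fin n)), z.length < w.length →
    coeff (basisDir d M n) w (mono z) = fun _ => 0
  | [], w, hw => by
      rw [mono_nil]
      exact coeff_const_eq_zero _ _ w (List.ne_nil_of_length_pos (by simpa using hw))
  | a :: z, w, hw => by
      rw [mono_cons, coeff_mul _ (contDiff_ev a) (contDiff_mono z) w]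
      funext φ
      apply List.sum_eq_zero
      intro r hr
      rw [List.mem_map] at hr
      obtain ⟨⟨w₁, w₂⟩, hpq, rfl⟩ := hr
      have hlen := length_add_of_mem_splits hpq
      simp only [List.length_cons] at hw hlen
      rcases w₁ with _ | ⟨b, _ | ⟨c, w₁⟩⟩
      · -- `w₁ = []`: `|w₂| = |w| > |z|`
        simp only [List.length_nil, zero_add] at hlen
        rw [congrFun (coeff_mono_eq_zero z w₂ (by omega)) φ, mul_zero]
      · simp only [List.length_singleton] at hlen
        rw [congrFun (coeff_mono_eq_zero z w₂ (by omega)) φ, mul_zero]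
      · rw [congrFun (coeff_ev_eq_zero a b c w₁) φ, zero_mul]

/-- `φ^z` has polynomial degree `|z|`. [folklore] -/
theorem polyDeg_mono (z : List (TorusSite d M × Fin n)) : PolyDeg (basisDir d M n) z.length (mono z) :=
  fun φ w hw => congrFun (coeff_mono_eq_zero z w hw) φ

/-- `|φ^z| ≤ ‖φ‖^{|z|}`. [folklore] -/
theorem abs_mono_le (z : List (TorusSite d M × Fin n)) (φ : TorusSite d M → Fin n → ℝ) : |mono z φ| ≤ ‖φ‖ ^ z.length := by
  induction z with
  | nil => simp [mono]
  | cons a z ih =>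
      rw [mono_cons]
      simp only [List.length_cons, pow_succ]
      rw [abs_mul, mul_comm]
      refine mul_le_mul ih ?_ (abs_nonneg _) (by positivity)
      calc |ev a φ| = ‖φ a.1 a.2‖ := rfl
        _ ≤ ‖φ a.1‖ := norm_le_pi_norm _ _
        _ ≤ ‖φ‖ := norm_le_pi_norm _ _

/-! ### The creation identity for `Δ_C` and `e^{tΔ_C}` -/

/-- `∂_v` commutes with `Δ_C` on smooth functions (symmetry of mixed partials). [folklore] -/
theorem coeff_single_lapC (Ch : TorusSite d M × Fin n → TorusSite d M × Fin n → ℝ) {F : (TorusSite d M → Fin n → ℝ) → ℝ}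
    (hF : ContDiff ℝ ∞ F) (v : TorusSite d M × Fin n) :
    coeff (basisDir d M n) [v] (lapC (basisDir d M n) Ch F) = lapC (basisDir d M n) Ch (coeff (basisDir d M n) [v] F) := by
  rw [coeff_lapC _ Ch hF [v]]
  funext φ
  simp only [lapC]
  refine Finset.sum_congr rfl fun p _ => Finset.sum_congr rfl fun q _ => ?_
  rw [coeff_coeff]
  congr 1
  have hperm : ([v] ++ [p, q]).Perm ([p, q] ++ [v]) := List.perm_append_comm
  exact congrFun (coeff_perm _ hperm hF) φ

/-- **`Δ_C(φ_u F) = φ_u Δ_CF + Σ_v (Ĉ_{uv} + Ĉ_{vu}) ∂_vF`.** [folklore] -/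
theorem lapC_ev_mul (Ch : TorusSite d M × Fin n → TorusSite d M × Fin n → ℝ) (u : TorusSite d M × Fin n)
    {F : (TorusSite d M → Fin n → ℝ) → ℝ} (hF : ContDiff ℝ ∞ F) :
    lapC (basisDir d M n) Ch (fun ψ => ev u ψ * F ψ) =
      fun φ => ev u φ * lapC (basisDir d M n) Ch F φ + ∑ v, (Ch u v + Ch v u) * coeff (basisDir d M n) [v] F φ := by
  rw [lapC_mul _ Ch (contDiff_ev u) hF]
  have h0 : lapC (basisDir d M n) Ch (ev u) = fun _ => 0 := by
    funext φ; simp only [lapC]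
    exact Finset.sum_eq_zero fun p _ => Finset.sum_eq_zero fun q _ => by rw [congrFun (coeff_ev_eq_zero u p q []) φ, mul_zero]
  have h1 : ∀ p, coeff (basisDir d M n) [p] (ev u) = fun _ => if u = p then 1 else 0 := fun p => by
    rw [coeff_cons, coeff_nil, dirDeriv_ev]
  funext φ
  rw [congrFun h0 φ, zero_mul, zero_add]
  simp only [h1, mul_add, Finset.sum_add_distrib, add_mul]
  congr 2
  · -- `Σ_p Σ_q Ĉ_{pq} δ_{up} F_q = Σ_q Ĉ_{uq} F_q`
    rw [Finset.sum_eq_single u]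
    · exact Finset.sum_congr rfl fun q _ => by simp
    · intro p _ hp
      exact Finset.sum_eq_zero fun q _ => by rw [if_neg (Ne.symm hp)]; ring
    · intro h; exact absurd (Finset.mem_univ _) h
  · -- `Σ_p Σ_q Ĉ_{pq} F_p δ_{uq} = Σ_p Ĉ_{pu} F_p`
    refine Finset.sum_congr rfl fun p _ => ?_
    rw [Finset.sum_eq_single u]
    · simp
    · intro q _ hq; rw [if_neg (Ne.symm hq)]; ring
    · intro h; exact absurd (Finset.mem_univ _) h

/-- Symmetric covariances: `Δ_C(φ_u F) = φ_u Δ_CF + 2Σ_v Ĉ_{uv} ∂_vF`. [folklore] -/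
theorem lapC_ev_mul_symm {Ch : TorusSite d M × Fin n → TorusSite d M × Fin n → ℝ} (hsym : ∀ p q, Ch p q = Ch q p)
    (u : TorusSite d M × Fin n) {F : (TorusSite d M → Fin n → ℝ) → ℝ} (hF : ContDiff ℝ ∞ F) :
    lapC (basisDir d M n) Ch (fun ψ => ev u ψ * F ψ) =
      fun φ => ev u φ * lapC (basisDir d M n) Ch F φ + 2 * ∑ v, Ch u v * coeff (basisDir d M n) [v] F φ := by
  rw [lapC_ev_mul Ch u hF]
  funext φ
  rw [Finset.mul_sum]
  congr 1
  exact Finset.sum_congr rfl fun v _ => by rw [hsym v u]; ring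

/-- **Iterated creation identity**: `Δ_C^k(φ_u F) = φ_u Δ_C^kF + 2k Σ_v Ĉ_{uv} ∂_v Δ_C^{k-1}F`
(symmetric `Ĉ`). [folklore] -/
theorem lapPow_ev_mul {Ch : TorusSite d M × Fin n → TorusSite d M × Fin n → ℝ} (hsym : ∀ p q, Ch p q = Ch q p)
    (u : TorusSite d M × Fin n) {F : (TorusSite d M → Fin n → ℝ) → ℝ} (hF : ContDiff ℝ ∞ F) :
    ∀ k : ℕ, lapPow (basisDir d M n) Ch (k + 1) (fun ψ => ev u ψ * F ψ) =
      fun φ => ev u φ * lapPow (basisDir d M n) Ch (k + 1) F φ +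
        2 * ((k + 1 : ℕ) : ℝ) * ∑ v, Ch u v * coeff (basisDir d M n) [v] (lapPow (basisDir d M n) Ch k F) φ
  | 0 => by
      simp only [lapPow_succ, lapPow_zero]
      rw [lapC_ev_mul_symm hsym u hF]
      funext φ; push_cast; ring
  | k + 1 => by
      rw [lapPow_succ, lapPow_ev_mul hsym u hF k]
      have hLk := contDiff_lapPow (basisDir d M n) Ch hF (k + 1)
      have hLk' := contDiff_lapPow (basisDir d M n) Ch hF k
      have hcv : ∀ v, ContDiff ℝ ∞ (coeff (basisDir d M n) [v] (lapPow (basisDir d M n) Ch k F)) := fun v => contDiff_coeff _ hLk' [v]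
      -- `Δ` of the two terms
      have hsplit : (fun φ => ev u φ * lapPow (basisDir d M n) Ch (k + 1) F φ +
          2 * ((k + 1 : ℕ) : ℝ) * ∑ v, Ch u v * coeff (basisDir d M n) [v] (lapPow (basisDir d M n) Ch k F) φ) =
          fun φ => (fun ψ => ev u ψ * lapPow (basisDir d M n) Ch (k + 1) F ψ) φ +
            (fun ψ => ∑ v, (2 * ((k + 1 : ℕ) : ℝ) * Ch u v) * coeff (basisDir d M n) [v] (lapPow (basisDir d M n) Ch k F) ψ) φ := by
        funext φ; simp only [Finset.mul_sum]; congr 1; exact Finset.sum_congr rfl fun v _ => by ring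
      rw [hsplit, lapC_add _ Ch ((contDiff_ev u).mul hLk) (ContDiff.sum fun v _ => contDiff_const.mul (hcv v)),
        lapC_ev_mul_symm hsym u hLk, lapC_finset_sum _ Ch _ (fun v _ => contDiff_const.mul (hcv v))]
      funext φ
      simp only [lapC_const_mul _ Ch _ (hcv _), ← lapPow_succ]
      have hcomm : ∀ v, lapC (basisDir d M n) Ch (coeff (basisDir d M n) [v] (lapPow (basisDir d M n) Ch k F)) φ =
          coeff (basisDir d M n) [v] (lapPow (basisDir d M n) Ch (k + 1) F) φ := by
        intro v; rw [lapPow_succ, coeff_single_lapC Ch hLk' v]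
      simp only [hcomm, Finset.mul_sum]
      push_cast
      rw [add_assoc, ← Finset.sum_add_distrib]
      congr 1
      exact Finset.sum_congr rfl fun v _ => by ring

/-- **Creation identity for the truncated exponential**:
`e^{tΔ_C}(φ_u F) = φ_u e^{tΔ_C}F + 2t Σ_v Ĉ_{uv} ∂_v(e^{tΔ_C}F)` for symmetric `Ĉ` and a
polynomial `F` of degree `≤ A < 2A'` (truncation order `A'`). With `t = ½`:
`e^{ℒ}(φ_u F) = φ_u e^{ℒ}F + Σ_v Ĉ_{uv} ∂_v e^{ℒ}F`. [folklore] -/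
theorem expLap_ev_mul {Ch : TorusSite d M × Fin n → TorusSite d M × Fin n → ℝ} (hsym : ∀ p q, Ch p q = Ch q p)
    (u : TorusSite d M × Fin n) {F : (TorusSite d M → Fin n → ℝ) → ℝ} (hF : ContDiff ℝ ∞ F)
    {A A' : ℕ} (hdeg : PolyDeg (basisDir d M n) A F) (hA : A < 2 * A') (t : ℝ) :
    expLap (basisDir d M n) Ch A' t (fun ψ => ev u ψ * F ψ) =
      fun φ => ev u φ * expLap (basisDir d M n) Ch A' t F φ +
        2 * t * ∑ v, Ch u v * coeff (basisDir d M n) [v] (expLap (basisDir d M n) Ch A' t F) φ := by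
  funext φ
  simp only [expLap]
  set c : ℕ → ℝ := fun k => t ^ k / (k.factorial : ℝ) with hc
  set D : TorusSite d M × Fin n → ℕ → ℝ := fun v j => coeff (basisDir d M n) [v] (lapPow (basisDir d M n) Ch j F) φ with hD
  -- coefficients of the exponential sum
  have hcoeff : ∀ v, coeff (basisDir d M n) [v] (fun φ => ∑ k ∈ range (A' + 1), c k * lapPow (basisDir d M n) Ch k F φ) φ =
      ∑ k ∈ range (A' + 1), c k * D v k := by
    intro v
    rw [coeff_finset_sum _ _ (fun k _ => contDiff_const.mul (contDiff_lapPow _ Ch hF k)) [v]]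
    exact Finset.sum_congr rfl fun k _ => by rw [congrFun (coeff_const_mul _ (contDiff_lapPow _ Ch hF k) _ [v]) φ]
  have hc_succ : ∀ k : ℕ, c (k + 1) * (2 * ((k + 1 : ℕ) : ℝ)) = 2 * t * c k := by
    intro k
    simp only [hc, Nat.factorial_succ, pow_succ]
    push_cast
    have hne : ((k.factorial : ℕ) : ℝ) ≠ 0 := by positivity
    have hne' : ((k : ℝ) + 1) ≠ 0 := by positivity
    field_simp
  -- the terms `k + 1` of the left-hand side
  have hk : ∀ k : ℕ, c (k + 1) * lapPow (basisDir d M n) Ch (k + 1) (fun ψ => ev u ψ * F ψ) φ =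
      ev u φ * (c (k + 1) * lapPow (basisDir d M n) Ch (k + 1) F φ) + 2 * t * ∑ v, Ch u v * (c k * D v k) := by
    intro k
    rw [congrFun (lapPow_ev_mul hsym u hF k) φ, mul_add, ← mul_assoc (c (k + 1)), ← mul_assoc (c (k + 1)), hc_succ]
    simp only [hD, Finset.mul_sum]
    congr 1
    · ring
    · exact Finset.sum_congr rfl fun v _ => by ring
  -- the top derivative vanishes: `∂_v Δ^{A'} F = 0` since `deg F ≤ A < 2A'`
  have htop : ∀ v, D v A' = 0 := fun v => coeff_lapPow_eq_zero _ Ch hF (hdeg φ) A' [v] (by simp; omega)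
  -- assemble
  show ∑ k ∈ range (A' + 1), c k * lapPow (basisDir d M n) Ch k (fun ψ => ev u ψ * F ψ) φ =
    ev u φ * ∑ k ∈ range (A' + 1), c k * lapPow (basisDir d M n) Ch k F φ +
      2 * t * ∑ v, Ch u v * coeff (basisDir d M n) [v] (fun φ => ∑ k ∈ range (A' + 1), c k * lapPow (basisDir d M n) Ch k F φ) φ
  simp only [hcoeff]
  rw [Finset.sum_range_succ' (fun k => c k * lapPow (basisDir d M n) Ch k (fun ψ => ev u ψ * F ψ) φ),
    Finset.sum_range_succ' (fun k => c k * lapPow (basisDir d M n) Ch k F φ)]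
  simp only [hk, Finset.sum_add_distrib, ← Finset.mul_sum, lapPow_zero]
  have hinner : ∀ v, ∑ k ∈ range (A' + 1), c k * D v k = ∑ k ∈ range A', c k * D v k := by
    intro v; rw [Finset.sum_range_succ, htop, mul_zero, add_zero]
  simp only [hinner]
  have hc0 : c 0 = 1 := by simp [hc]
  rw [hc0, one_mul, one_mul]
  have hswap : ∑ k ∈ range A', ∑ v, Ch u v * (c k * D v k) = ∑ v, Ch u v * ∑ k ∈ range A', c k * D v k := by
    rw [Finset.sum_comm]; exact Finset.sum_congr rfl fun v _ => by rw [Finset.mul_sum]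
  rw [hswap]
  ring


/-! ### Integrability against `P_C` and the operator `T = E_Cθ` on polynomially bounded functions -/

/-- **Polynomially bounded functions are `P_C`-integrable.** [folklore] -/
theorem integrable_fieldGaussian_of_abs_le (C : Matrix (TorusSite d M) (TorusSite d M) ℝ)
    {G : (TorusSite d M → Fin n → ℝ) → ℝ} (hm : Continuous G) {B : ℝ} {p : ℕ}
    (hb : ∀ ζ, |G ζ| ≤ B * (1 + ‖ζ‖) ^ p) : Integrable G (fieldGaussian (TorusSite d M) C n) := by
  have hB : 0 ≤ B := by have := hb 0; simp at this; exact (abs_nonneg _).trans this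
  rw [fieldGaussian_eq_map_gaussMap]
  refine (integrable_map_measure hm.aestronglyMeasurable (gaussMap C n).continuous.measurable.aemeasurable).2 ?_
  set A := gaussMap (Λ := TorusSite d M) C n with hA
  refine integrable_piGauss_of_abs_le (hm.comp A.continuous).aestronglyMeasurable (B := B * (1 + ‖A‖) ^ p) (p := p) fun z => ?_
  have hnormA : 1 + ‖A z‖ ≤ (1 + ‖A‖) * (1 + ‖z‖) := by
    have h1 := A.le_opNorm z
    have h2 : 0 ≤ ‖A‖ := norm_nonneg _
    have h3 : 0 ≤ ‖z‖ := norm_nonneg _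
    nlinarith
  calc |G (A z)| ≤ B * (1 + ‖A z‖) ^ p := hb _
    _ ≤ B * ((1 + ‖A‖) * (1 + ‖z‖)) ^ p := mul_le_mul_of_nonneg_left (pow_le_pow_left₀ (by positivity) hnormA p) hB
    _ = B * (1 + ‖A‖) ^ p * (1 + ‖z‖) ^ p := by rw [mul_pow]; ring
    _ ≤ B * (1 + ‖A‖) ^ p * ∏ j, (1 + |z j|) ^ p := mul_le_mul_of_nonneg_left (one_add_norm_pow_le_prod z p) (by positivity)

/-- Shifted monomials are polynomially bounded: `|φ^z(φ+ζ)| ≤ (1+‖φ‖)^{|z|}(1+‖ζ‖)^{|z|}`. [folklore] -/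
theorem abs_mono_shift_le (z : List (TorusSite d M × Fin n)) (φ ζ : TorusSite d M → Fin n → ℝ) :
    |mono z (φ + ζ)| ≤ (1 + ‖φ‖) ^ z.length * (1 + ‖ζ‖) ^ z.length := by
  refine (abs_mono_le z _).trans ?_
  rw [← mul_pow]
  apply pow_le_pow_left₀ (norm_nonneg _)
  calc ‖φ + ζ‖ ≤ ‖φ‖ + ‖ζ‖ := norm_add_le _ _
    _ ≤ (1 + ‖φ‖) * (1 + ‖ζ‖) := by nlinarith [norm_nonneg φ, norm_nonneg ζ]

/-- The derivative of a monomial in the coordinate expansion. [folklore] -/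
theorem fderiv_mono_apply (z : List (TorusSite d M × Fin n)) (ψ w : TorusSite d M → Fin n → ℝ) :
    fderiv ℝ (mono z) ψ w = ∑ ξ : TorusSite d M × Fin n, w ξ.1 ξ.2 * coeff (basisDir d M n) [ξ] (mono z) ψ :=
  fderiv_apply_eq_sum ψ w

/-- `‖D(φ^z)(ψ)‖ ≤ N·|z|·(1+‖ψ‖)^{|z|}` (`N` the number of labels). [folklore] -/
theorem norm_fderiv_mono_le (z : List (TorusSite d M × Fin n)) (ψ : TorusSite d M → Fin n → ℝ) :
    ‖fderiv ℝ (mono z) ψ‖ ≤ (Fintype.card (TorusSite d M × Fin n) : ℝ) * z.length * (1 + ‖ψ‖) ^ z.length := by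
  have hpos : (0 : ℝ) ≤ (Fintype.card (TorusSite d M × Fin n) : ℝ) * z.length * (1 + ‖ψ‖) ^ z.length := by
    have h1 : (0 : ℝ) ≤ Fintype.card (TorusSite d M × Fin n) := Nat.cast_nonneg _
    have h2 : (0 : ℝ) ≤ z.length := Nat.cast_nonneg _
    have h3 : (0 : ℝ) ≤ (1 + ‖ψ‖) ^ z.length := by positivity
    exact mul_nonneg (mul_nonneg h1 h2) h3
  refine ContinuousLinearMap.opNorm_le_bound _ hpos fun w => ?_
  rw [fderiv_mono_apply]
  have hterm : ∀ ξ : TorusSite d M × Fin n, ‖w ξ.1 ξ.2 * coeff (basisDir d M n) [ξ] (mono z) ψ‖ ≤ z.length * (1 + ‖ψ‖) ^ z.length * ‖w‖ := by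
    intro ξ
    rw [norm_mul]
    have hw : ‖w ξ.1 ξ.2‖ ≤ ‖w‖ := (norm_le_pi_norm (w ξ.1) ξ.2).trans (norm_le_pi_norm w ξ.1)
    have hc : ‖coeff (basisDir d M n) [ξ] (mono z) ψ‖ ≤ z.length * (1 + ‖ψ‖) ^ z.length := by
      rw [congrFun (coeff_single_mono ξ z) ψ, Real.norm_eq_abs]
      refine (Finset.abs_sum_le_sum_abs _ _).trans ?_
      have hk : ∀ k ∈ range z.length, |(if z[k]? = some ξ then mono (z.eraseIdx k) ψ else 0)| ≤ (1 + ‖ψ‖) ^ z.length := by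
        intro k hk
        split_ifs
        · refine (abs_mono_le _ ψ).trans ?_
          calc ‖ψ‖ ^ (z.eraseIdx k).length ≤ (1 + ‖ψ‖) ^ (z.eraseIdx k).length :=
                pow_le_pow_left₀ (norm_nonneg _) (by linarith [norm_nonneg ψ]) _
            _ ≤ (1 + ‖ψ‖) ^ z.length := pow_le_pow_right₀ (by linarith [norm_nonneg ψ]) (by rw [List.length_eraseIdx]; split_ifs <;> omega)
        · rw [abs_zero]; positivity
      refine (Finset.sum_le_sum hk).trans ?_
      rw [Finset.sum_const, Finset.card_range, nsmul_eq_mul]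
    calc ‖w ξ.1 ξ.2‖ * ‖coeff (basisDir d M n) [ξ] (mono z) ψ‖ ≤ ‖w‖ * (z.length * (1 + ‖ψ‖) ^ z.length) :=
          mul_le_mul hw hc (norm_nonneg _) (norm_nonneg _)
      _ = z.length * (1 + ‖ψ‖) ^ z.length * ‖w‖ := by ring
  refine (norm_sum_le _ _).trans ((Finset.sum_le_sum fun ξ _ => hterm ξ).trans ?_)
  rw [Finset.sum_const, Finset.card_univ, nsmul_eq_mul]
  ring_nf
  rfl

/-- **The `T`-side creation identity**: for positive semidefinite `C`,
`E_Cθ(φ_u φ^z)(φ) = φ_u E_Cθ(φ^z)(φ) + Σ_y C_{xy} E_Cθ(∂_{(y,i)}φ^z)(φ)` (`u = (x,i)`), from Gaussian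
integration by parts. [cite: BrydgesSlade2015RGI, §2] -/
theorem thetaConv_ev_mul_mono {C : Matrix (TorusSite d M) (TorusSite d M) ℝ} (hC : C.PosSemidef)
    (x : TorusSite d M) (i : Fin n) (z : List (TorusSite d M × Fin n)) (φ : TorusSite d M → Fin n → ℝ) :
    thetaConv (fieldGaussian (TorusSite d M) C n) (fun ψ => ev (x, i) ψ * mono z ψ) φ =
      ev (x, i) φ * thetaConv (fieldGaussian (TorusSite d M) C n) (mono z) φ +
        ∑ y, C x y * thetaConv (fieldGaussian (TorusSite d M) C n) (coeff (basisDir d M n) [(y, i)] (mono z)) φ := by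
  set P := fieldGaussian (TorusSite d M) C n with hP
  set G : (TorusSite d M → Fin n → ℝ) → ℝ := fun ζ => mono z (φ + ζ) with hG
  have hGs : ContDiff ℝ 1 G := ((contDiff_mono z).comp (contDiff_const.add contDiff_id)).of_le (by norm_cast)
  have hGc : Continuous G := hGs.continuous
  set B : ℝ := (Fintype.card (TorusSite d M × Fin n) : ℝ) * (z.length + 1) * (1 + ‖φ‖) ^ z.length with hB
  have hB1 : (1 + ‖φ‖) ^ z.length ≤ B := by
    rw [hB]
    have h1 : (1 : ℝ) ≤ (Fintype.card (TorusSite d M × Fin n) : ℝ) * (z.length + 1) := by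
      have hc : (1 : ℝ) ≤ Fintype.card (TorusSite d M × Fin n) := by
        have : 0 < Fintype.card (TorusSite d M × Fin n) := Fintype.card_pos_iff.2 ⟨((fun _ => 0), i)⟩
        exact_mod_cast this
      nlinarith [show (0 : ℝ) ≤ z.length from Nat.cast_nonneg _]
    nlinarith [show (0 : ℝ) ≤ (1 + ‖φ‖) ^ z.length from by positivity]
  have hGb : ∀ ζ, |G ζ| ≤ B * (1 + ‖ζ‖) ^ z.length := fun ζ =>
    (abs_mono_shift_le z φ ζ).trans (mul_le_mul_of_nonneg_right hB1 (by positivity))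
  have hfd : ∀ ζ w, fderiv ℝ G ζ w = fderiv ℝ (mono z) (φ + ζ) w := by
    intro ζ w
    have h1 : HasFDerivAt (fun ζ : TorusSite d M → Fin n → ℝ => φ + ζ) (ContinuousLinearMap.id ℝ _) ζ :=
      (hasFDerivAt_id ζ).const_add φ
    have h2 : HasFDerivAt G ((fderiv ℝ (mono z) (φ + ζ)).comp (ContinuousLinearMap.id ℝ _)) ζ :=
      ((differentiable_of_contDiff (contDiff_mono z)) (φ + ζ)).hasFDerivAt.comp ζ h1
    rw [h2.fderiv]
    rfl
  have hG'b : ∀ ζ, ‖fderiv ℝ G ζ‖ ≤ B * (1 + ‖ζ‖) ^ z.length := by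
    intro ζ
    have heq : fderiv ℝ G ζ = fderiv ℝ (mono z) (φ + ζ) := ContinuousLinearMap.ext (hfd ζ)
    rw [heq]
    refine (norm_fderiv_mono_le z (φ + ζ)).trans ?_
    have hshift : (1 + ‖φ + ζ‖) ^ z.length ≤ (1 + ‖φ‖) ^ z.length * (1 + ‖ζ‖) ^ z.length := by
      rw [← mul_pow]
      apply pow_le_pow_left₀ (by positivity)
      nlinarith [norm_add_le φ ζ, norm_nonneg φ, norm_nonneg ζ]
    calc (Fintype.card (TorusSite d M × Fin n) : ℝ) * z.length * (1 + ‖φ + ζ‖) ^ z.length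
        ≤ (Fintype.card (TorusSite d M × Fin n) : ℝ) * (z.length + 1) * ((1 + ‖φ‖) ^ z.length * (1 + ‖ζ‖) ^ z.length) := by
          apply mul_le_mul _ hshift (by positivity) (by positivity)
          nlinarith [show (0 : ℝ) ≤ Fintype.card (TorusSite d M × Fin n) from Nat.cast_nonneg _, show (0 : ℝ) ≤ z.length from Nat.cast_nonneg _]
      _ = B * (1 + ‖ζ‖) ^ z.length := by rw [hB]; ring
  -- integration by parts
  have hibp := fieldGaussian_ibp (Λ := TorusSite d M) hC hGs hGb hG'b x i
  -- integrability of the two pieces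
  have hintG : Integrable G P := integrable_fieldGaussian_of_abs_le C hGc hGb
  have hintζG : Integrable (fun ζ : TorusSite d M → Fin n → ℝ => ζ x i * G ζ) P := by
    refine integrable_fieldGaussian_of_abs_le C (by fun_prop) (B := B) (p := z.length + 1) fun ζ => ?_
    rw [abs_mul, pow_succ]
    have hζ : |ζ x i| ≤ 1 + ‖ζ‖ := by
      have : ‖ζ x i‖ ≤ ‖ζ‖ := (norm_le_pi_norm (ζ x) i).trans (norm_le_pi_norm ζ x)
      rw [Real.norm_eq_abs] at this; linarith
    calc |ζ x i| * |G ζ| ≤ (1 + ‖ζ‖) * (B * (1 + ‖ζ‖) ^ z.length) := mul_le_mul hζ (hGb ζ) (abs_nonneg _) (by positivity)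
      _ = B * ((1 + ‖ζ‖) ^ z.length * (1 + ‖ζ‖)) := by ring
  -- compute
  simp only [thetaConv]
  have hsplit : ∀ ζ : TorusSite d M → Fin n → ℝ, ev (x, i) (φ + ζ) * mono z (φ + ζ) = ev (x, i) φ * G ζ + ζ x i * G ζ := by
    intro ζ; simp only [ev, hG, Pi.add_apply]; ring
  simp only [hsplit]
  rw [integral_add (hintG.const_mul _) hintζG, integral_const_mul, hibp]
  congr 1
  refine Finset.sum_congr rfl fun y _ => ?_
  congr 1
  refine integral_congr_ae (ae_of_all _ fun ζ => ?_)
  show fderiv ℝ G ζ (fdir y i) = coeff (basisDir d M n) [(y, i)] (mono z) (φ + ζ)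
  rw [hfd, coeff_cons, coeff_nil]
  rfl

/-! ### `E_Cθ = e^{ℒ_C}` on monomials, by induction on the degree -/

/-- `∂_v` commutes with `Δ_C^k`. [folklore] -/
theorem coeff_single_lapPow (Ch : TorusSite d M × Fin n → TorusSite d M × Fin n → ℝ) {F : (TorusSite d M → Fin n → ℝ) → ℝ}
    (hF : ContDiff ℝ ∞ F) (v : TorusSite d M × Fin n) :
    ∀ k, coeff (basisDir d M n) [v] (lapPow (basisDir d M n) Ch k F) = lapPow (basisDir d M n) Ch k (coeff (basisDir d M n) [v] F)
  | 0 => rfl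
  | k + 1 => by
      rw [lapPow_succ, coeff_single_lapC Ch (contDiff_lapPow _ Ch hF k) v, coeff_single_lapPow Ch hF v k, lapPow_succ]

/-- `∂_v` commutes with `e^{tΔ_C}`. [folklore] -/
theorem coeff_single_expL (C : TorusSite d M → TorusSite d M → ℝ) (A : ℕ) (t : ℝ) {F : (TorusSite d M → Fin n → ℝ) → ℝ}
    (hF : ContDiff ℝ ∞ F) (v : TorusSite d M × Fin n) :
    coeff (basisDir d M n) [v] (expL C A t F) = expL C A t (coeff (basisDir d M n) [v] F) := by
  unfold expL expLap
  rw [coeff_finset_sum _ _ (fun k _ => contDiff_const.mul (contDiff_lapPow _ _ hF k)) [v]]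
  funext φ
  refine Finset.sum_congr rfl fun k _ => ?_
  rw [congrFun (coeff_const_mul _ (contDiff_lapPow _ _ hF k) _ [v]) φ, congrFun (coeff_single_lapPow _ hF v k) φ]

/-- `Δ_C^{k+1}c = 0`. [folklore] -/
theorem lapPow_succ_const (C : TorusSite d M → TorusSite d M → ℝ) (c : ℝ) :
    ∀ k : ℕ, lapPow (basisDir d M n) (lapCov C) (k + 1) (fun _ : TorusSite d M → Fin n → ℝ => c) = fun _ => 0
  | 0 => by rw [lapPow_succ, lapPow_zero, lapC_const]
  | k + 1 => by rw [lapPow_succ, lapPow_succ_const C c k, lapC_const]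

/-- `e^{tΔ_C}c = c`. [folklore] -/
theorem expL_const (C : TorusSite d M → TorusSite d M → ℝ) (A : ℕ) (t c : ℝ) :
    expL C A t (fun _ : TorusSite d M → Fin n → ℝ => c) = fun _ => c := by
  funext φ
  unfold expL expLap
  rw [Finset.sum_eq_single 0]
  · simp
  · intro k _ hk
    obtain ⟨k', rfl⟩ := Nat.exists_eq_succ_of_ne_zero hk
    rw [lapPow_succ_const]; simp
  · intro h; exact absurd (Finset.mem_range.2 (Nat.succ_pos A)) h

omit [NeZero M] in
/-- A positive semidefinite covariance is symmetric, and so is its lift to the labels. [folklore] -/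
theorem lapCov_symm {C : Matrix (TorusSite d M) (TorusSite d M) ℝ} (hC : C.PosSemidef) (p q : TorusSite d M × Fin n) :
    lapCov (n := n) C p q = lapCov C q p := by
  have h : ∀ x y, C x y = C y x := fun x y => by
    have := hC.1.apply x y
    simpa using this.symm
  simp only [lapCov]
  by_cases hpq : p.2 = q.2
  · rw [if_pos hpq, if_pos hpq.symm, h]
  · rw [if_neg hpq, if_neg (Ne.symm hpq)]

/-- `T = E_Cθ` of a constant. [folklore] -/
theorem thetaConv_const (C : Matrix (TorusSite d M) (TorusSite d M) ℝ) (c : ℝ) (φ : TorusSite d M → Fin n → ℝ) :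
    thetaConv (fieldGaussian (TorusSite d M) C n) (fun _ => c) φ = c := by
  simp [thetaConv]

/-- `T = E_Cθ` is additive over finite sums of polynomially bounded continuous functions. [folklore] -/
theorem thetaConv_finset_sum (C : Matrix (TorusSite d M) (TorusSite d M) ℝ) {β : Type*} (s : Finset β)
    {G : β → (TorusSite d M → Fin n → ℝ) → ℝ} (hG : ∀ b ∈ s, Continuous (G b))
    (hb : ∀ b ∈ s, ∃ (B : ℝ) (p : ℕ), ∀ ζ, |G b ζ| ≤ B * (1 + ‖ζ‖) ^ p) (φ : TorusSite d M → Fin n → ℝ) :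
    thetaConv (fieldGaussian (TorusSite d M) C n) (fun ψ => ∑ b ∈ s, G b ψ) φ =
      ∑ b ∈ s, thetaConv (fieldGaussian (TorusSite d M) C n) (G b) φ := by
  simp only [thetaConv]
  rw [integral_finsetSum _ fun b hbs => ?_]
  obtain ⟨B, p, hBp⟩ := hb b hbs
  have hB : 0 ≤ B := by have := hBp 0; simp at this; exact (abs_nonneg _).trans this
  refine integrable_fieldGaussian_of_abs_le C ((hG b hbs).comp (continuous_const.add continuous_id)) (B := B * (1 + ‖φ‖) ^ p)
    (p := p) fun ζ => (hBp (φ + ζ)).trans ?_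
  rw [mul_assoc, ← mul_pow]
  exact mul_le_mul_of_nonneg_left (pow_le_pow_left₀ (by positivity) (by nlinarith [norm_add_le φ ζ, norm_nonneg φ, norm_nonneg ζ]) p) hB

/-- `T` of a scalar multiple. [folklore] -/
theorem thetaConv_const_mul (C : Matrix (TorusSite d M) (TorusSite d M) ℝ) (c : ℝ) (G : (TorusSite d M → Fin n → ℝ) → ℝ)
    (φ : TorusSite d M → Fin n → ℝ) :
    thetaConv (fieldGaussian (TorusSite d M) C n) (fun ψ => c * G ψ) φ = c * thetaConv (fieldGaussian (TorusSite d M) C n) G φ := by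
  simp only [thetaConv]
  exact integral_const_mul c _

/-- **Wick's theorem for monomials: `E_Cθ(φ^z) = e^{ℒ_C}φ^z`** (`ℒ_C = ½Δ_C`; truncation order
`A'` with `|z| ≤ 2A'`), by induction on `|z|` from the two creation identities. [cite: BrydgesSlade2015RGI, §2 (Gaussian expectation as e^{½Δ_C} on polynomials)] -/
theorem thetaConv_mono {C : Matrix (TorusSite d M) (TorusSite d M) ℝ} (hC : C.PosSemidef) (A' : ℕ) :
    ∀ (N : ℕ) (z : List (TorusSite d M × Fin n)), z.length = N → N ≤ 2 * A' → ∀ φ,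
      thetaConv (fieldGaussian (TorusSite d M) C n) (mono z) φ = expL C A' 2⁻¹ (mono z) φ := by
  intro N
  induction N using Nat.strong_induction_on with
  | _ N ih =>
    intro z hz hN φ
    match z, hz with
    | [], _ =>
        rw [mono_nil, thetaConv_const, expL_const]
    | (x, i) :: z', hz =>
        simp only [List.length_cons] at hz
        have hz' : z'.length = N - 1 := by omega
        have hlt : N - 1 < N := by omega
        have ih1 : ∀ φ, thetaConv (fieldGaussian (TorusSite d M) C n) (mono z') φ = expL C A' 2⁻¹ (mono z') φ :=
          fun φ => ih (N - 1) hlt z' hz' (by omega) φ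
        have ih2 : ∀ (k : ℕ) φ, k < z'.length →
            thetaConv (fieldGaussian (TorusSite d M) C n) (mono (z'.eraseIdx k)) φ = expL C A' 2⁻¹ (mono (z'.eraseIdx k)) φ := by
          intro k φ hk
          refine ih (N - 2) (by omega) _ ?_ (by omega) φ
          rw [List.length_eraseIdx, if_pos hk]; omega
        -- `T` and `H` of `∂_{(y,i)}φ^{z'}`, a sum of shorter monomials
        have hderiv : ∀ y, thetaConv (fieldGaussian (TorusSite d M) C n) (coeff (basisDir d M n) [(y, i)] (mono z')) φ =
            expL C A' 2⁻¹ (coeff (basisDir d M n) [(y, i)] (mono z')) φ := by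
          intro y
          rw [coeff_single_mono]
          have hsum : (fun φ => ∑ k ∈ range z'.length, (if z'[k]? = some (y, i) then mono (z'.eraseIdx k) φ else 0)) =
              fun φ => ∑ k ∈ range z'.length, (if z'[k]? = some (y, i) then (1 : ℝ) else 0) * mono (z'.eraseIdx k) φ := by
            funext ψ; exact Finset.sum_congr rfl fun k _ => by split_ifs <;> simp
          rw [hsum, thetaConv_finset_sum C (range z'.length)
            (G := fun k ψ => (if z'[k]? = some (y, i) then (1 : ℝ) else 0) * mono (z'.eraseIdx k) ψ)
            (fun k _ => continuous_const.mul (contDiff_mono _).continuous)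
            (fun k _ => ⟨1, (z'.eraseIdx k).length, fun ζ => by
              rw [abs_mul]
              calc |(if z'[k]? = some (y, i) then (1 : ℝ) else 0)| * |mono (z'.eraseIdx k) ζ| ≤ 1 * ‖ζ‖ ^ (z'.eraseIdx k).length := by
                    refine mul_le_mul ?_ (abs_mono_le _ ζ) (abs_nonneg _) zero_le_one
                    split_ifs <;> simp
                _ ≤ 1 * (1 + ‖ζ‖) ^ (z'.eraseIdx k).length :=
                    mul_le_mul_of_nonneg_left (pow_le_pow_left₀ (norm_nonneg _) (by linarith [norm_nonneg ζ]) _) zero_le_one⟩),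
            expL_finset_sum C A' _ _ (fun k _ => contDiff_const.mul (contDiff_mono _))]
          refine Finset.sum_congr rfl fun k hk => ?_
          rw [thetaConv_const_mul, congrFun (expL_const_mul C A' _ _ (contDiff_mono _)) φ, ih2 k φ (Finset.mem_range.1 hk)]
        -- the two creation identities
        rw [mono_cons, thetaConv_ev_mul_mono hC x i z' φ, ih1 φ]
        have hH := congrFun (expLap_ev_mul (fun p q => lapCov_symm hC p q) (x, i) (contDiff_mono z') (polyDeg_mono z')
          (A' := A') (by omega) (2⁻¹ : ℝ)) φ
        show _ = expL C A' 2⁻¹ (fun ψ => ev (x, i) ψ * mono z' ψ) φ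
        unfold expL at hH ⊢
        rw [hH]
        congr 1
        rw [show (2 : ℝ) * 2⁻¹ = 1 by norm_num, one_mul, Fintype.sum_prod_type]
        refine Finset.sum_congr rfl fun y _ => ?_
        rw [Finset.sum_eq_single i]
        · have hce := congrFun (coeff_single_expL C A' 2⁻¹ (contDiff_mono z') (y, i)) φ
          unfold expL at hce
          rw [hderiv y, hce]
          simp [lapCov, expL]
        · intro j _ hj; simp [lapCov, Ne.symm hj]
        · intro h; exact absurd (Finset.mem_univ _) h

/-! ### `E_Cθ = e^{ℒ_C}` on all polynomials -/

omit [NeZero M] in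
/-- The coordinate power of the coordinate vector is the monomial. [folklore] -/
theorem cpow_fieldFn (ψ : TorusSite d M → Fin n → ℝ) (z : List (TorusSite d M × Fin n)) : cpow (fieldFn ψ) z = mono z ψ := rfl

/-- **Exact Taylor expansion in monomials**: a polynomial `F` of degree `≤ A` is
`F(ψ) = Σ_{k ≤ A} (k!)⁻¹ Σ_{|z| = k} F_z(0) ψ^z`. [folklore] -/
theorem eq_sum_mono {F : (TorusSite d M → Fin n → ℝ) → ℝ} (hF : ContDiff ℝ ∞ F) {A : ℕ} (hdeg : PolyDeg (basisDir d M n) A F) :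
    F = fun ψ => ∑ k ∈ range (A + 1), ((k.factorial : ℝ)⁻¹) *
      ∑ v : Fin k → TorusSite d M × Fin n, coeff (basisDir d M n) (List.ofFn v) F 0 * mono (List.ofFn v) ψ := by
  funext ψ
  have h := coeff_apply_eq_taylor (basisDir d M n) (fieldFn ψ) hF (A := A) (fun z hz ψ' => hdeg ψ' z hz) []
  rw [coeff_nil, sum_fieldFn_smul_basisDir] at h
  rw [h]
  refine Finset.sum_congr rfl fun k _ => ?_
  congr 1
  rw [sumSeq_eq_sum_fn]
  exact Finset.sum_congr rfl fun v _ => by rw [List.append_nil, cpow_fieldFn, mul_comm]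

/-- **`E_Cθ F = e^{ℒ_C}F` for every polynomial `F`** ("the Gaussian expectation acts on polynomials
as `e^{½Δ_C}`"; [BS-rg-norm] §2, Slade §4.3 `E_Cθ A = e^{ℒ_C}A`): for positive semidefinite `C`,
smooth `F` whose coefficients of length `> A` vanish, and truncation order `A'` with `A ≤ 2A'`,
`∫ F(φ + ζ) dP_C(ζ) = Σ_{k ≤ A'} (½)^k/k! Δ_C^kF(φ)`. [cite: BrydgesSlade2015RGI, §2 (E_C θ = e^{½Δ_C} on polynomials)] [cite: Slade2017, §4.3 (e^{ℒ_C}, "power series expansion, which terminates when applied to a polynomial")] -/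
theorem thetaConv_eq_expL {C : Matrix (TorusSite d M) (TorusSite d M) ℝ} (hC : C.PosSemidef)
    {F : (TorusSite d M → Fin n → ℝ) → ℝ} (hF : ContDiff ℝ ∞ F) {A A' : ℕ} (hdeg : PolyDeg (basisDir d M n) A F) (hA : A ≤ 2 * A') :
    thetaConv (fieldGaussian (TorusSite d M) C n) F = expL C A' 2⁻¹ F := by
  have hT := eq_sum_mono hF hdeg
  funext φ
  rw [hT]
  -- push `T` and `e^{ℒ}` through the double sum
  have hin : ∀ k, ContDiff ℝ ∞ (fun ψ : TorusSite d M → Fin n → ℝ =>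
      ∑ v : Fin k → TorusSite d M × Fin n, coeff (basisDir d M n) (List.ofFn v) F 0 * mono (List.ofFn v) ψ) :=
    fun k => ContDiff.sum fun v _ => contDiff_const.mul (contDiff_mono _)
  rw [thetaConv_finset_sum C (range (A + 1))
      (G := fun k ψ => ((k.factorial : ℝ)⁻¹) * ∑ v : Fin k → TorusSite d M × Fin n, coeff (basisDir d M n) (List.ofFn v) F 0 * mono (List.ofFn v) ψ)
      (fun k _ => (contDiff_const.mul (hin k)).continuous)
      (fun k _ => ⟨((k.factorial : ℝ)⁻¹) * ∑ v : Fin k → TorusSite d M × Fin n, |coeff (basisDir d M n) (List.ofFn v) F 0|, k, fun ζ => by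
        rw [abs_mul, abs_of_nonneg (by positivity), mul_assoc, Finset.sum_mul]
        refine mul_le_mul_of_nonneg_left ((Finset.abs_sum_le_sum_abs _ _).trans (Finset.sum_le_sum fun v _ => ?_)) (by positivity)
        rw [abs_mul]
        refine mul_le_mul_of_nonneg_left ((abs_mono_le _ ζ).trans ?_) (abs_nonneg _)
        rw [List.length_ofFn]
        exact pow_le_pow_left₀ (norm_nonneg _) (by linarith [norm_nonneg ζ]) k⟩),
    expL_finset_sum C A' _ _ (fun k _ => contDiff_const.mul (hin k))]
  refine Finset.sum_congr rfl fun k hk => ?_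
  have hkA : k ≤ 2 * A' := by have := Finset.mem_range.1 hk; omega
  rw [thetaConv_const_mul, congrFun (expL_const_mul C A' _ _ (hin k)) φ]
  congr 1
  rw [thetaConv_finset_sum C Finset.univ (G := fun v ψ => coeff (basisDir d M n) (List.ofFn v) F 0 * mono (List.ofFn v) ψ)
      (fun v _ => (contDiff_const.mul (contDiff_mono _)).continuous)
      (fun v _ => ⟨|coeff (basisDir d M n) (List.ofFn v) F 0|, k, fun ζ => by
        rw [abs_mul]
        refine mul_le_mul_of_nonneg_left ((abs_mono_le _ ζ).trans ?_) (abs_nonneg _)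
        rw [List.length_ofFn]
        exact pow_le_pow_left₀ (norm_nonneg _) (by linarith [norm_nonneg ζ]) k⟩),
    congrFun (expL_finset_sum C A' _ _ (fun v _ => contDiff_const.mul (contDiff_mono _))) φ]
  refine Finset.sum_congr rfl fun v _ => ?_
  rw [thetaConv_const_mul, congrFun (expL_const_mul C A' _ _ (contDiff_mono _)) φ,
    thetaConv_mono hC A' k (List.ofFn v) (List.length_ofFn) hkA φ]

end Wick

end LongRangePhi4

end Literature.Barriers.CriticalPhenomena

end
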